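import Literature.Probability.Divergences.RenyiTailcutRelativeError
import Mathlib.Topology.Algebra.InfiniteSum.Real
import HarnessLib

/-!
# [Pre17] tailcut and relative error lemmas for SUMMABLE weight families (countable carriers)

Topic `Probability/Divergences`; namespace `Literature.Probability.Divergences`. PROVED, no definition, no named fact.
`RenyiTailcutRelativeError.lean` proves [Pre17] §3.1 Lemma 2 (tailcut) and §3.2 Lemma 3 (relative error) for weight vectors
on a `Fintype` (`renyiSumFin`). The distributions of [Pre17] §4 (Klein / KGPV samplers over lattice cosets, the FN-DSA
«ffSampling» row) live on COUNTABLE carriers; this file restates both lemmas for arbitrary index types with real, nonnegative,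
SUMMABLE weights and `tsum`s — the same per-point inequalities (`rpow_mul_rpow_le_of_ratio_le`,
`rpow_mul_rpow_le_relativeError`) summed with Mathlib's summable-series order lemmas. PRINTED STATEMENTS (held volume
`book:editornd-advances-cryptology-asiacrypt-2017`, chunks p0469–p0470): Lemma 2 «𝒟_δ/𝒟 ≤ 1 + δ over Supp(𝒟_δ) ⇒
R_a(𝒟_δ‖𝒟) ≤ 1 + δ»; Lemma 3 «Supp(𝒟_δ) = Supp(𝒟), 1 − δ ≤ 𝒟_δ/𝒟 ≤ 1 + δ ⇒ R_a(𝒟_δ‖𝒟) ≤ (1 + a(a−1)δ²/(2(1−δ)^{a+1}))^{1/(a−1)}»,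
with `R_a(P‖Q)^{a−1} = Σ_x P(x)^a Q(x)^{1−a}` ([Pre17] §2.2 Def. 1). `P` = printed `𝒟_δ`, `Q` = printed `𝒟`.

* `summable_rpow_mul_rpow_of_ratio_le`, `tsum_rpow_mul_rpow_le_tailcut`, `tsum_rpow_le_tailcut` — Lemma 2;
* `summable_rpow_mul_rpow_of_relativeError`, `tsum_rpow_mul_rpow_le_relativeError`, `tsum_rpow_le_relativeError` — Lemma 3.
-/

noncomputable section

open Real

namespace Literature.Probability.Divergences

variable {X : Type*}

/-! ## Lemma 2 (tailcut), summable form -/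

/-- Under `P ≤ (1+δ)Q` pointwise (`P, Q ≥ 0`, `a > 1`) and `P` summable, the Rényi summand `P^a Q^{1−a}` is summable.
[cite: Prest2017RenyiSharperBounds, §3.1 Lemma 2 (proof: termwise domination by `(1+δ)^{a−1} P`)] -/
theorem summable_rpow_mul_rpow_of_ratio_le {a δ : ℝ} (ha : 1 < a) {P Q : X → ℝ} (hP : ∀ x, 0 ≤ P x)
    (hQ : ∀ x, 0 ≤ Q x) (hratio : ∀ x, P x ≤ (1 + δ) * Q x) (hPs : Summable P) :
    Summable fun x => P x ^ a * Q x ^ (1 - a) :=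
  Summable.of_nonneg_of_le (fun x => rpow_mul_rpow_nonneg a hP hQ x)
    (fun x => rpow_mul_rpow_le_of_ratio_le ha (hP x) (hQ x) (hratio x)) (hPs.mul_left _)

/-- **Lemma 2 (tailcut), power-sum form on a countable carrier**: `Σ' P^a Q^{1−a} ≤ (1+δ)^{a−1} · Σ' P`.
[cite: Prest2017RenyiSharperBounds, §3.1 Lemma 2 (proof display)] -/
theorem tsum_rpow_mul_rpow_le_tailcut {a δ : ℝ} (ha : 1 < a) {P Q : X → ℝ} (hP : ∀ x, 0 ≤ P x)
    (hQ : ∀ x, 0 ≤ Q x) (hratio : ∀ x, P x ≤ (1 + δ) * Q x) (hPs : Summable P) :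
    ∑' x, P x ^ a * Q x ^ (1 - a) ≤ (1 + δ) ^ (a - 1) * ∑' x, P x := by
  rw [← hPs.tsum_mul_left]
  exact Summable.tsum_le_tsum (fun x => rpow_mul_rpow_le_of_ratio_le ha (hP x) (hQ x) (hratio x))
    (summable_rpow_mul_rpow_of_ratio_le ha hP hQ hratio hPs) (hPs.mul_left _)

/-- **Lemma 2 (tailcut) on a countable carrier**: `(Σ' P^a Q^{1−a})^{1/(a−1)} ≤ 1 + δ` when moreover `Σ' P ≤ 1`, `δ ≥ 0`.
[cite: Prest2017RenyiSharperBounds, §3.1 Lemma 2] -/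
theorem tsum_rpow_le_tailcut {a δ : ℝ} (ha : 1 < a) (hδ : 0 ≤ δ) {P Q : X → ℝ} (hP : ∀ x, 0 ≤ P x)
    (hQ : ∀ x, 0 ≤ Q x) (hratio : ∀ x, P x ≤ (1 + δ) * Q x) (hPs : Summable P) (hP1 : ∑' x, P x ≤ 1) :
    (∑' x, P x ^ a * Q x ^ (1 - a)) ^ (1 / (a - 1)) ≤ 1 + δ := by
  have ha1 : 0 < a - 1 := by linarith
  have h0 : 0 ≤ ∑' x, P x ^ a * Q x ^ (1 - a) := tsum_nonneg fun x => rpow_mul_rpow_nonneg a hP hQ x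
  have h1 : ∑' x, P x ^ a * Q x ^ (1 - a) ≤ (1 + δ) ^ (a - 1) := by
    calc ∑' x, P x ^ a * Q x ^ (1 - a) ≤ (1 + δ) ^ (a - 1) * ∑' x, P x :=
          tsum_rpow_mul_rpow_le_tailcut ha hP hQ hratio hPs
      _ ≤ (1 + δ) ^ (a - 1) * 1 := mul_le_mul_of_nonneg_left hP1 (by positivity)
      _ = (1 + δ) ^ (a - 1) := mul_one _
  calc (∑' x, P x ^ a * Q x ^ (1 - a)) ^ (1 / (a - 1)) ≤ ((1 + δ) ^ (a - 1)) ^ (1 / (a - 1)) :=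
        Real.rpow_le_rpow h0 h1 (by positivity)
    _ = 1 + δ := by rw [← Real.rpow_mul (by linarith), mul_one_div_cancel ha1.ne', Real.rpow_one]

/-! ## Lemma 3 (relative error), summable form -/

/-- Under the relative error hypotheses the Rényi summand is summable (dominated by
`P + (1−a)(Q−P) + K·P`). [cite: Prest2017RenyiSharperBounds, §3.2 Lemma 3 (proof: per-point Taylor bound)] -/
theorem summable_rpow_mul_rpow_of_relativeError {a δ : ℝ} (ha : 1 < a) (hδ0 : 0 ≤ δ) (hδ1 : δ < 1) {P Q : X → ℝ}
    (hP : ∀ x, 0 ≤ P x) (hQ : ∀ x, 0 ≤ Q x) (hlo : ∀ x, (1 - δ) * Q x ≤ P x)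
    (hhi : ∀ x, P x ≤ (1 + δ) * Q x) (hPs : Summable P) (hQs : Summable Q) :
    Summable fun x => P x ^ a * Q x ^ (1 - a) := by
  have ha0 : 0 < a := by linarith
  set K : ℝ := a * (a - 1) * δ ^ 2 / (2 * (1 - δ) ^ (a + 1)) with hK
  refine Summable.of_nonneg_of_le (fun x => rpow_mul_rpow_nonneg a hP hQ x)
    (fun x => ?_) ((hPs.add ((hQs.sub hPs).mul_left (1 - a))).add (hPs.mul_left K))
  -- the per-point bound (as in the finite file)
  show P x ^ a * Q x ^ (1 - a) ≤ P x + (1 - a) * (Q x - P x) + K * P x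
  rcases (hP x).eq_or_lt with hp0 | hp0
  · have hq0 : Q x = 0 := by
      have h1 := hlo x
      rw [← hp0] at h1
      have : 0 < 1 - δ := by linarith
      nlinarith [hQ x]
    rw [← hp0, hq0, Real.zero_rpow ha0.ne']
    simp
  · have hq0 : 0 < Q x := by
      rcases (hQ x).eq_or_lt with hq0 | hq0
      · have h1 := hhi x
        rw [← hq0, mul_zero] at h1
        linarith
      · exact hq0
    exact rpow_mul_rpow_le_relativeError ha hδ0 hδ1 hp0 hq0 (hlo x) (hhi x)

/-- **Lemma 3 (relative error), power-sum form on a countable carrier**: for summable probability families `P`, `Q`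
(`Σ' P = Σ' Q = 1`) with `(1−δ)Q ≤ P ≤ (1+δ)Q` pointwise, `0 ≤ δ < 1`, `a > 1`:
`Σ' P^a Q^{1−a} ≤ 1 + a(a−1)δ²/(2(1−δ)^{a+1})`. [cite: Prest2017RenyiSharperBounds, §3.2 Lemma 3 (proof, last display)] -/
theorem tsum_rpow_mul_rpow_le_relativeError {a δ : ℝ} (ha : 1 < a) (hδ0 : 0 ≤ δ) (hδ1 : δ < 1) {P Q : X → ℝ}
    (hP : ∀ x, 0 ≤ P x) (hQ : ∀ x, 0 ≤ Q x) (hlo : ∀ x, (1 - δ) * Q x ≤ P x)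
    (hhi : ∀ x, P x ≤ (1 + δ) * Q x) (hPs : Summable P) (hQs : Summable Q) (hP1 : ∑' x, P x = 1)
    (hQ1 : ∑' x, Q x = 1) :
    ∑' x, P x ^ a * Q x ^ (1 - a) ≤ 1 + a * (a - 1) * δ ^ 2 / (2 * (1 - δ) ^ (a + 1)) := by
  have ha0 : 0 < a := by linarith
  set K : ℝ := a * (a - 1) * δ ^ 2 / (2 * (1 - δ) ^ (a + 1)) with hK
  have hpt : ∀ x, P x ^ a * Q x ^ (1 - a) ≤ P x + (1 - a) * (Q x - P x) + K * P x := by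
    intro x
    rcases (hP x).eq_or_lt with hp0 | hp0
    · have hq0 : Q x = 0 := by
        have h1 := hlo x
        rw [← hp0] at h1
        have : 0 < 1 - δ := by linarith
        nlinarith [hQ x]
      rw [← hp0, hq0, Real.zero_rpow ha0.ne']
      simp
    · have hq0 : 0 < Q x := by
        rcases (hQ x).eq_or_lt with hq0 | hq0
        · have h1 := hhi x
          rw [← hq0, mul_zero] at h1
          linarith
        · exact hq0
      exact rpow_mul_rpow_le_relativeError ha hδ0 hδ1 hp0 hq0 (hlo x) (hhi x)
  have hUs : Summable fun x => P x + (1 - a) * (Q x - P x) + K * P x :=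
    (hPs.add ((hQs.sub hPs).mul_left (1 - a))).add (hPs.mul_left K)
  have hU : ∑' x, (P x + (1 - a) * (Q x - P x) + K * P x) = 1 + K := by
    rw [(hPs.add ((hQs.sub hPs).mul_left (1 - a))).tsum_add (hPs.mul_left K),
      hPs.tsum_add ((hQs.sub hPs).mul_left (1 - a)), (hQs.sub hPs).tsum_mul_left (1 - a),
      hQs.tsum_sub hPs, hPs.tsum_mul_left K, hP1, hQ1]
    ring
  calc ∑' x, P x ^ a * Q x ^ (1 - a) ≤ ∑' x, (P x + (1 - a) * (Q x - P x) + K * P x) :=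
        Summable.tsum_le_tsum hpt (summable_rpow_mul_rpow_of_relativeError ha hδ0 hδ1 hP hQ hlo hhi hPs hQs) hUs
    _ = 1 + K := hU

/-- **Lemma 3 (relative error) on a countable carrier**: `R_a(𝒟_δ‖𝒟) = (Σ' P^a Q^{1−a})^{1/(a−1)} ≤
(1 + a(a−1)δ²/(2(1−δ)^{a+1}))^{1/(a−1)}`. [cite: Prest2017RenyiSharperBounds, §3.2 Lemma 3] -/
theorem tsum_rpow_le_relativeError {a δ : ℝ} (ha : 1 < a) (hδ0 : 0 ≤ δ) (hδ1 : δ < 1) {P Q : X → ℝ}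
    (hP : ∀ x, 0 ≤ P x) (hQ : ∀ x, 0 ≤ Q x) (hlo : ∀ x, (1 - δ) * Q x ≤ P x)
    (hhi : ∀ x, P x ≤ (1 + δ) * Q x) (hPs : Summable P) (hQs : Summable Q) (hP1 : ∑' x, P x = 1)
    (hQ1 : ∑' x, Q x = 1) :
    (∑' x, P x ^ a * Q x ^ (1 - a)) ^ (1 / (a - 1))
      ≤ (1 + a * (a - 1) * δ ^ 2 / (2 * (1 - δ) ^ (a + 1))) ^ (1 / (a - 1)) := by
  have ha1 : 0 < a - 1 := by linarith
  exact Real.rpow_le_rpow (tsum_nonneg fun x => rpow_mul_rpow_nonneg a hP hQ x)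
    (tsum_rpow_mul_rpow_le_relativeError ha hδ0 hδ1 hP hQ hlo hhi hPs hQs hP1 hQ1) (by positivity)

end Literature.Probability.Divergences

end
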